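import Summits.QuantumFields.GaugeBoot.DiagonalRPTorusReplicaJet
import Mathlib.MeasureTheory.Integral.Prod
import HarnessLib

/-!
# The jet coefficient under lonely-link vanishing (gauge-boot, L3 `d = 3` uniform window, J2 brick 5)

HONEST FRAMING (cell `pub-gaugeboot`, page 1 of every file): the venture produces certified bounds
on lattice expectations at stated coupling, gauge group, dimension and torus size; NOT a mass gap,
NOT a continuum limit, NOT a string tension; NOT Yang–Mills-summit-bearing (barriers
`FixedCouplingUltralocality`, `PerturbativeInvisibility`). This module is bookkeeping for a
structural NEGATIVE result (a coupling window UNIFORM in the torus size for the failure of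
inner-half diagonal reflection positivity on `(ℤ/L)^3`, plan note
`HOME/pub-gaugeboot-lean3/gen46/D3-UNIFORM-PLAN.md` §3 item 6c (J2)); it discharges nothing by
itself.

## Content (torus `(ℤ/L)^d`, compact metrisable `G`, continuous `ρ`, any `d`)

With `r_q = Re tr ρ(U_q)`, `R_B = ∏_{q ∈ B} r_q`, `E[h] = ∫ h dU` (product Haar):

* `integral_mul_prod_neg_cost` — `∫ h ∏_{q ∈ A} (-(N - r_q)) = Σ_{B ⊆ A} (-N)^{#(A∖B)} E[h R_B]`;
* ★★ **`jetCoeff_eq_two_mul`** — if `E[f R_B] = E[g R_B] = 0` for all `B ⊆ Q` and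
  `E[f g R_B] = 0` for all `B ⊊ Q` (the LONELY-LINK VANISHING of the sub-diagrams), then
  `jetCoeff f g Q = 2 · E[f g R_Q]`: the doubled moment of `DiagonalRPTorusReplicaJet` is twice
  the single connected diagram (`Finset.prod_add` twice, Fubini `integral_prod_mul`).

Hence (bricks 4 + 5) `replicaTerm f g Q z = 2 E[f g R_Q] z^{#Q} + O(z^{#Q+1})`. Elementary; no
named fact.
-/

open MeasureTheory Finset Function

namespace Summit.QuantumFields.GaugeBoot

open Literature.MathematicalPhysics.QuantumFieldTheory

noncomputable section

namespace DiagRPUnif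

open DiagRPTube

variable {d L : ℕ} [NeZero L] {N : ℕ} {G : Type*} [Group G] [TopologicalSpace G]
  [IsTopologicalGroup G] [CompactSpace G] [MeasurableSpace G] [BorelSpace G]
  [SecondCountableTopology G] (ρ : G →* Matrix (Fin N) (Fin N) ℂ)

/-- The product of plaquette characters `R_B = ∏_{q ∈ B} Re tr ρ(U_q)`. -/
def plaqProd (B : Finset (Plaquette d L)) (V : GaugeConfig d L G) : ℝ := ∏ q ∈ B, WilsonRP.plaqRe ρ V q

omit [NeZero L] [MeasurableSpace G] [BorelSpace G] [SecondCountableTopology G] [CompactSpace G] in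
/-- `R_B` is continuous. -/
theorem continuous_plaqProd (hρ : Continuous ρ) (B : Finset (Plaquette d L)) :
    Continuous (plaqProd (G := G) ρ B) :=
  continuous_finsetProd _ fun q _ => continuous_plaqRe ρ hρ q

omit [NeZero L] [MeasurableSpace G] [BorelSpace G] [SecondCountableTopology G] in
/-- `|R_B| ≤ N^{#B}`. -/
theorem abs_plaqProd_le (hρ : Continuous ρ) (B : Finset (Plaquette d L)) (V : GaugeConfig d L G) :
    |plaqProd ρ B V| ≤ (N : ℝ) ^ B.card := by
  unfold plaqProd
  rw [abs_prod, ← prod_const]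
  exact prod_le_prod (fun _ _ => abs_nonneg _) fun q _ => WilsonRP.abs_plaqRe_le ρ hρ V q

/-- A bounded measurable function times `R_B` is integrable. -/
theorem integrable_mul_plaqProd (hρ : Continuous ρ) {h : GaugeConfig d L G → ℝ} (hm : Measurable h)
    {C : ℝ} (hb : ∀ U, |h U| ≤ C) (B : Finset (Plaquette d L)) :
    Integrable (fun V => h V * plaqProd ρ B V) (Measure.pi fun _ : Edge d L => haarProbability G) := by
  refine Integrable.of_bound (hm.mul (continuous_plaqProd ρ hρ B).measurable).aestronglyMeasurable
    (C * (N : ℝ) ^ B.card) (ae_of_all _ fun V => ?_)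
  rw [Real.norm_eq_abs, abs_mul]
  exact mul_le_mul (hb V) (abs_plaqProd_le ρ hρ B V) (abs_nonneg _) ((abs_nonneg _).trans (hb V))

/-! ## Expanding the costs -/

/-- ★ `∫ h ∏_{q ∈ A} (-(N - r_q)) = Σ_{B ⊆ A} (-N)^{#(A ∖ B)} ∫ h R_B`. -/
theorem integral_mul_prod_neg_cost (hρ : Continuous ρ) {h : GaugeConfig d L G → ℝ}
    (hm : Measurable h) {C : ℝ} (hb : ∀ U, |h U| ≤ C) (A : Finset (Plaquette d L)) :
    ∫ V, h V * ∏ q ∈ A, (-(cost ρ q V)) ∂Measure.pi (fun _ : Edge d L => haarProbability G) =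
      ∑ B ∈ A.powerset, (-(N : ℝ)) ^ (A \ B).card *
        ∫ V, h V * plaqProd ρ B V ∂Measure.pi (fun _ : Edge d L => haarProbability G) := by
  classical
  have hexp : ∀ V : GaugeConfig d L G, h V * ∏ q ∈ A, (-(cost ρ q V)) =
      ∑ B ∈ A.powerset, (-(N : ℝ)) ^ (A \ B).card * (h V * plaqProd ρ B V) := by
    intro V
    have : ∀ q, -(cost ρ q V) = WilsonRP.plaqRe ρ V q + (-(N : ℝ)) := fun q => by
      unfold cost; ring
    simp_rw [this, prod_add, prod_const, mul_sum, plaqProd]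
    refine sum_congr rfl fun B _ => ?_
    ring
  simp_rw [hexp]
  rw [integral_finsetSum _ fun B _ => (integrable_mul_plaqProd ρ hρ hm hb B).const_mul _]
  refine sum_congr rfl fun B _ => ?_
  rw [integral_const_mul]

/-- If every `E[h R_B]`, `B ⊆ A`, vanishes, so does `∫ h ∏_{q ∈ A} (-(N - r_q))`. -/
theorem integral_mul_prod_neg_cost_eq_zero (hρ : Continuous ρ) {h : GaugeConfig d L G → ℝ}
    (hm : Measurable h) {C : ℝ} (hb : ∀ U, |h U| ≤ C) (A : Finset (Plaquette d L))
    (h0 : ∀ B, B ⊆ A → ∫ V, h V * plaqProd ρ B V ∂Measure.pi (fun _ : Edge d L => haarProbability G) = 0) :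
    ∫ V, h V * ∏ q ∈ A, (-(cost ρ q V)) ∂Measure.pi (fun _ : Edge d L => haarProbability G) = 0 := by
  rw [integral_mul_prod_neg_cost ρ hρ hm hb A]
  exact sum_eq_zero fun B hB => by rw [h0 B (mem_powerset.1 hB), mul_zero]

/-- If every `E[h R_B]`, `B ⊊ Q`, vanishes, then `∫ h ∏_{q ∈ Q} (-(N - r_q)) = E[h R_Q]`. -/
theorem integral_mul_prod_neg_cost_eq_top (hρ : Continuous ρ) {h : GaugeConfig d L G → ℝ}
    (hm : Measurable h) {C : ℝ} (hb : ∀ U, |h U| ≤ C) (Q : Finset (Plaquette d L))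
    (h0 : ∀ B, B ⊆ Q → B ≠ Q →
      ∫ V, h V * plaqProd ρ B V ∂Measure.pi (fun _ : Edge d L => haarProbability G) = 0) :
    ∫ V, h V * ∏ q ∈ Q, (-(cost ρ q V)) ∂Measure.pi (fun _ : Edge d L => haarProbability G) =
      ∫ V, h V * plaqProd ρ Q V ∂Measure.pi (fun _ : Edge d L => haarProbability G) := by
  classical
  rw [integral_mul_prod_neg_cost ρ hρ hm hb Q, sum_eq_single_of_mem Q (mem_powerset.2 subset_rfl)]
  · simp
  · intro B hB hne
    rw [h0 B (mem_powerset.1 hB) hne, mul_zero]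

/-! ## The jet coefficient -/

/-- ★★ **THE JET COEFFICIENT IS TWICE THE CONNECTED DIAGRAM** under lonely-link vanishing:
`jetCoeff f g Q = 2 · E[f g R_Q]`. -/
theorem jetCoeff_eq_two_mul (hρ : Continuous ρ) {f g : GaugeConfig d L G → ℝ} (hfm : Measurable f)
    (hgm : Measurable g) {Cf Cg : ℝ} (hfb : ∀ U, |f U| ≤ Cf) (hgb : ∀ U, |g U| ≤ Cg)
    (Q : Finset (Plaquette d L))
    (hVf : ∀ B, B ⊆ Q → ∫ V, f V * plaqProd ρ B V ∂Measure.pi (fun _ : Edge d L => haarProbability G) = 0)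
    (hVg : ∀ B, B ⊆ Q → ∫ V, g V * plaqProd ρ B V ∂Measure.pi (fun _ : Edge d L => haarProbability G) = 0)
    (hVfg : ∀ B, B ⊆ Q → B ≠ Q →
      ∫ V, f V * g V * plaqProd ρ B V ∂Measure.pi (fun _ : Edge d L => haarProbability G) = 0) :
    jetCoeff ρ f g Q =
      2 * ∫ V, f V * g V * plaqProd ρ Q V ∂Measure.pi (fun _ : Edge d L => haarProbability G) := by
  classical
  set π := Measure.pi fun _ : Edge d L => haarProbability G with hπ
  have hCf : 0 ≤ Cf := (abs_nonneg _).trans (hfb 1)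
  have hCg : 0 ≤ Cg := (abs_nonneg _).trans (hgb 1)
  have hfgm : Measurable fun V => f V * g V := hfm.mul hgm
  have hfgb : ∀ U, |f U * g U| ≤ Cf * Cg := fun U => by
    rw [abs_mul]; exact mul_le_mul (hfb U) (hgb U) (abs_nonneg _) hCf
  have h1m : Measurable fun _ : GaugeConfig d L G => (1 : ℝ) := measurable_const
  have h1b : ∀ U : GaugeConfig d L G, |(1 : ℝ)| ≤ 1 := fun _ => by simp
  -- `T_A(h) = ∫ h ∏_{A} (-cost)`
  set T : (GaugeConfig d L G → ℝ) → Finset (Plaquette d L) → ℝ :=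
    fun h A => ∫ V, h V * ∏ q ∈ A, (-(cost ρ q V)) ∂π with hT
  have hTf : ∀ A, A ⊆ Q → T f A = 0 := fun A hA =>
    integral_mul_prod_neg_cost_eq_zero ρ hρ hfm hfb A fun B hB => hVf B (hB.trans hA)
  have hTg : ∀ A, A ⊆ Q → T g A = 0 := fun A hA =>
    integral_mul_prod_neg_cost_eq_zero ρ hρ hgm hgb A fun B hB => hVg B (hB.trans hA)
  have hTfg0 : ∀ A, A ⊆ Q → A ≠ Q → T (fun V => f V * g V) A = 0 := fun A hA hne =>
    integral_mul_prod_neg_cost_eq_zero ρ hρ hfgm hfgb A fun B hB =>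
      hVfg B (hB.trans hA) fun h => hne (subset_antisymm hA (h ▸ hB))
  have hTfgQ : T (fun V => f V * g V) Q = ∫ V, f V * g V * plaqProd ρ Q V ∂π :=
    integral_mul_prod_neg_cost_eq_top ρ hρ hfgm hfgb Q hVfg
  have hT1 : T (fun _ => 1) ∅ = 1 := by
    simp [hT, hπ]
  -- integrability of the pieces
  have hint : ∀ {h : GaugeConfig d L G → ℝ}, Measurable h → ∀ {C : ℝ}, (∀ U, |h U| ≤ C) →
      ∀ A : Finset (Plaquette d L), Integrable (fun V => h V * ∏ q ∈ A, (-(cost ρ q V))) π := by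
    intro h hm C hb A
    refine Integrable.of_bound (hm.mul (Finset.measurable_prod _ fun q _ =>
      (continuous_cost ρ hρ q).measurable.neg)).aestronglyMeasurable (C * (2 * N) ^ A.card)
      (ae_of_all _ fun V => ?_)
    rw [Real.norm_eq_abs, abs_mul, abs_prod]
    refine mul_le_mul (hb V) ?_ (by positivity) ((abs_nonneg _).trans (hb V))
    rw [← prod_const]
    exact prod_le_prod (fun _ _ => abs_nonneg _) fun q _ => by
      rw [abs_neg]; exact abs_cost_le ρ hρ q V
  -- expand the doubled product and apply Fubini termwise
  have hexpand : ∀ p : GaugeConfig d L G × GaugeConfig d L G,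
      (f p.1 - f p.2) * (g p.1 - g p.2) * ∏ q ∈ Q, (-(cost ρ q p.1 + cost ρ q p.2)) =
        ∑ A ∈ Q.powerset,
          ((f p.1 * g p.1 * ∏ q ∈ A, (-(cost ρ q p.1))) * ((1 : ℝ) * ∏ q ∈ Q \ A, (-(cost ρ q p.2))) -
           (f p.1 * ∏ q ∈ A, (-(cost ρ q p.1))) * (g p.2 * ∏ q ∈ Q \ A, (-(cost ρ q p.2))) -
           (g p.1 * ∏ q ∈ A, (-(cost ρ q p.1))) * (f p.2 * ∏ q ∈ Q \ A, (-(cost ρ q p.2))) +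
           ((1 : ℝ) * ∏ q ∈ A, (-(cost ρ q p.1))) * (f p.2 * g p.2 * ∏ q ∈ Q \ A, (-(cost ρ q p.2)))) := by
    intro p
    have : ∀ q, -(cost ρ q p.1 + cost ρ q p.2) = -(cost ρ q p.1) + -(cost ρ q p.2) := fun q => by ring
    simp_rw [this, prod_add, mul_sum]
    refine sum_congr rfl fun A _ => ?_
    ring
  unfold jetCoeff
  rw [← hπ]
  simp_rw [hexpand]
  -- each summand is integrable on `π ⊗ π` and integrates to a product
  have hprod : ∀ {u v : GaugeConfig d L G → ℝ}, Integrable u π → Integrable v π →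
      Integrable (fun p : GaugeConfig d L G × GaugeConfig d L G => u p.1 * v p.2) (π.prod π) ∧
        ∫ p, u p.1 * v p.2 ∂(π.prod π) = (∫ V, u V ∂π) * ∫ V, v V ∂π :=
    fun hu hv => ⟨hu.mul_prod hv, integral_prod_mul _ _⟩
  have I1 := fun A => hprod (hint hfgm hfgb A) (hint h1m h1b (Q \ A))
  have I2 := fun A => hprod (hint hfm hfb A) (hint hgm hgb (Q \ A))
  have I3 := fun A => hprod (hint hgm hgb A) (hint hfm hfb (Q \ A))
  have I4 := fun A => hprod (hint h1m h1b A) (hint hfgm hfgb (Q \ A))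
  have hI : ∀ A ∈ Q.powerset, Integrable (fun p : GaugeConfig d L G × GaugeConfig d L G =>
      ((f p.1 * g p.1 * ∏ q ∈ A, (-(cost ρ q p.1))) * ((1 : ℝ) * ∏ q ∈ Q \ A, (-(cost ρ q p.2))) -
           (f p.1 * ∏ q ∈ A, (-(cost ρ q p.1))) * (g p.2 * ∏ q ∈ Q \ A, (-(cost ρ q p.2))) -
           (g p.1 * ∏ q ∈ A, (-(cost ρ q p.1))) * (f p.2 * ∏ q ∈ Q \ A, (-(cost ρ q p.2))) +
           ((1 : ℝ) * ∏ q ∈ A, (-(cost ρ q p.1))) * (f p.2 * g p.2 * ∏ q ∈ Q \ A, (-(cost ρ q p.2)))))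
      (π.prod π) := fun A _ =>
    (((I1 A).1.sub (I2 A).1).sub (I3 A).1).add (I4 A).1
  rw [integral_finsetSum _ hI]
  have hterm : ∀ A ∈ Q.powerset,
      ∫ p, ((f p.1 * g p.1 * ∏ q ∈ A, (-(cost ρ q p.1))) * ((1 : ℝ) * ∏ q ∈ Q \ A, (-(cost ρ q p.2))) -
           (f p.1 * ∏ q ∈ A, (-(cost ρ q p.1))) * (g p.2 * ∏ q ∈ Q \ A, (-(cost ρ q p.2))) -
           (g p.1 * ∏ q ∈ A, (-(cost ρ q p.1))) * (f p.2 * ∏ q ∈ Q \ A, (-(cost ρ q p.2))) +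
           ((1 : ℝ) * ∏ q ∈ A, (-(cost ρ q p.1))) * (f p.2 * g p.2 * ∏ q ∈ Q \ A, (-(cost ρ q p.2))))
          ∂(π.prod π) =
        T (fun V => f V * g V) A * T (fun _ => 1) (Q \ A) + T (fun _ => 1) A * T (fun V => f V * g V) (Q \ A) := by
    intro A hA
    have hAQ : A ⊆ Q := mem_powerset.1 hA
    have K123 : Integrable (fun p : GaugeConfig d L G × GaugeConfig d L G =>
        (f p.1 * g p.1 * ∏ q ∈ A, (-(cost ρ q p.1))) * ((1 : ℝ) * ∏ q ∈ Q \ A, (-(cost ρ q p.2))) -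
          (f p.1 * ∏ q ∈ A, (-(cost ρ q p.1))) * (g p.2 * ∏ q ∈ Q \ A, (-(cost ρ q p.2))) -
          (g p.1 * ∏ q ∈ A, (-(cost ρ q p.1))) * (f p.2 * ∏ q ∈ Q \ A, (-(cost ρ q p.2))))
        (π.prod π) := ((I1 A).1.sub (I2 A).1).sub (I3 A).1
    have K12 : Integrable (fun p : GaugeConfig d L G × GaugeConfig d L G =>
        (f p.1 * g p.1 * ∏ q ∈ A, (-(cost ρ q p.1))) * ((1 : ℝ) * ∏ q ∈ Q \ A, (-(cost ρ q p.2))) -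
          (f p.1 * ∏ q ∈ A, (-(cost ρ q p.1))) * (g p.2 * ∏ q ∈ Q \ A, (-(cost ρ q p.2))))
        (π.prod π) := (I1 A).1.sub (I2 A).1
    rw [integral_add K123 (I4 A).1, integral_sub K12 (I3 A).1, integral_sub (I1 A).1 (I2 A).1,
      (I1 A).2, (I2 A).2, (I3 A).2, (I4 A).2]
    have e2 : (∫ V, f V * ∏ q ∈ A, (-(cost ρ q V)) ∂π) = 0 := hTf A hAQ
    have e3 : (∫ V, g V * ∏ q ∈ A, (-(cost ρ q V)) ∂π) = 0 := hTg A hAQ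
    simp only [hT]
    rw [e2, e3]
    ring
  rw [sum_congr rfl hterm]
  -- only `A = Q` and `A = ∅` survive
  have hvan : ∀ A ∈ Q.powerset,
      T (fun V => f V * g V) A * T (fun _ => 1) (Q \ A) + T (fun _ => 1) A * T (fun V => f V * g V) (Q \ A) =
        (if A = Q then T (fun V => f V * g V) Q * T (fun _ => 1) ∅ else 0) +
          (if A = ∅ then T (fun _ => 1) ∅ * T (fun V => f V * g V) Q else 0) := by
    intro A hA
    have hAQ : A ⊆ Q := mem_powerset.1 hA
    congr 1
    · split_ifs with h
      · rw [h, sdiff_self]; rfl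
      · rw [hTfg0 A hAQ h, zero_mul]
    · split_ifs with h
      · rw [h, sdiff_empty]
      · rw [hTfg0 (Q \ A) sdiff_subset ?_, mul_zero]
        intro hh
        apply h
        have hdis : Disjoint Q A := sdiff_eq_self_iff_disjoint.1 hh
        exact (Finset.disjoint_self_iff_empty _).1 (hdis.mono_left hAQ)
  rw [sum_congr rfl hvan, sum_add_distrib, sum_ite_eq', sum_ite_eq', if_pos (mem_powerset.2 subset_rfl),
    if_pos (empty_mem_powerset Q), hTfgQ, hT1]
  ring

end DiagRPUnif

end

end Summit.QuantumFields.GaugeBoot
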